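import Mathlib
import HarnessLib
import HarnessLib.Audit
import Summits.Parity.Statement
import HarnessLib.Audit.Status.Attr

/-!
Route: VanishingDimension

DORMANT since 2026-08-24T11:40:57Z (reconciler: no traction for 6.7 d (last activity item-evidence-added at 2026-08-17T17:10:06Z); parked, not closed — `ledger route dormant route-Parity-VanishingDimension --off` to reactivate) — unstaffed, not closed; items shared with open routes are served there. `ledger route dormant <id> --off` reactivates.

# Route VanishingDimension — Bateman–Horn as the dimension→0 limit of the sieve on the z^ω-tilted
host at level x^θ

Resurrects the 2001 line tp/fractional-divisor-lift (Maynard's "lift reducing the sieve dimension",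
ICM 2022 Q23; STATUS proving,
sieve step refereed and Lean-formalised there for twins) for EVERY Bateman–Horn system f =
(f_1,…,f_k) and in ASYMPTOTIC form. Tilt the
argument sequence by the positive weight w(n) = z^(Σ_i ω(f_i(n))) (0 < z < 1): its sieve classes n ≡
r (d), d | ∏f_i(r), have exact local
densities g(d,r) = ∏_(p|d) z^(#{i: p|f_i(r)})/m_p, m_p = Σ_(s mod p) z^(#{i: p|f_i(s)}), so the host
has sieve dimension κ ≍ kz, and the
β-sieve/Buchstab sandwich at s = 1 (sifting range = level = x^θ, ANY fixed θ > 0) gives Σ_(n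
x^θ-rough) w(n) = A₁(x)·V(x)·(1 + O(κ log(1/κ)))
while every rough n that is not a prime tuple carries an extra factor z. It suffices to show X = K1
∧ K2 ∧ K3: (K1 = TiltedLevel, r2)
RELATIVE level of distribution x^θ of the tilted host in root classes, to ℓ¹(g)-precision o(A₁V) ≈
o((log x)^(-2κ)), with the explicit
local factor g and the size law S = ∏_i (1 − log d_i(r)/(deg f_i·log x))^(z−1); (K2 =
TiltCalibration, r3) the z → 0⁺ germ of the
calibrated tilted mass (log x)^k A₁V/(z^k x) is C(f)/∏deg f_i; (K3 = DimensionZeroSandwich, r4) the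
two-sided dimension-κ sieve at s = 1
with κ → 0 (an unpublished internal dependency, declared as a crux). Supports: RoughTupleBound
(Selberg upper bound), PrimeCellExtraction.
Lean: `(∀ (k : ℕ) (f : Fin k → Polynomial ℤ), Literature.NumberTheory.Sieve.IsBatemanHornSystem f →
∃ θ : ℝ, 0 < θ ∧ θ ≤ 1 / 4 ∧ ∃ z₀ : ℝ, 0 < z₀ ∧ ∀ z : ℝ, 0 < z → z < z₀ → let w : ℕ → ℝ := fun n =>
z ^ (∑ i, ArithmeticFunction.cardDistinctFactors (((f i).eval (n : ℤ)).toNat)); let A : ℕ → ℕ → ℕ →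
ℝ := fun x d r => ∑ n ∈ (Finset.Icc 1 x).filter (fun n : ℕ => n ≡ r [MOD d]), w n; let cnt : ℕ → ℕ →
ℕ := fun p s => (Finset.univ.filter (fun i => (p : ℤ) ∣ (f i).eval (s : ℤ))).card; let m : ℕ → ℝ :=
fun p => ∑ s ∈ Finset.range p, z ^ cnt p s; let g : ℕ → ℕ → ℝ := fun d r => ∏ p ∈ d.primeFactors, z
^ cnt p r / m p; let S : ℕ → ℕ → ℕ → ℝ := fun x d r => ∏ i, (1 - (∑ p ∈ d.primeFactors.filter (fun p
: ℕ => (p : ℤ) ∣ (f i).eval (r : ℤ)), Real.log p) / (((f i).natDegree : ℝ) * Real.log x)) ^ (z - 1);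
let V : ℕ → ℝ := fun x => ∏ p ∈ (Finset.range ⌊(x : ℝ) ^ θ⌋₊).filter Nat.Prime, ((p : ℝ) -
Literature.NumberTheory.Sieve.polyRootCountMod f p) / m p; (fun x : ℕ => ∑ d ∈ (Finset.Icc 1 ⌊(x :
ℝ) ^ θ⌋₊).filter Squarefree, ∑ r ∈ (Finset.range d).filter (fun r : ℕ => (d : ℤ) ∣ ∏ i, (f i).eval
(r : ℤ)), |A x d r - g d r * S x d r * ∑ n ∈ Finset.Icc 1 x, w n|) =o[atTop] fun x : ℕ => (∑ n ∈
Finset.Icc 1 x, w n) * V x) ∧ (∀ (k : ℕ) (f : Fin k → Polynomial ℤ),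
Literature.NumberTheory.Sieve.IsBatemanHornSystem f → ∀ θ : ℝ, 0 < θ → θ ≤ 1 / 4 → ∀ ε : ℝ, 0 < ε →
∃ z₂ : ℝ, 0 < z₂ ∧ ∀ z : ℝ, 0 < z → z < z₂ → let w : ℕ → ℝ := fun n => z ^ (∑ i,
ArithmeticFunction.cardDistinctFactors (((f i).eval (n : ℤ)).toNat)); let cnt : ℕ → ℕ → ℕ := fun p s
=> (Finset.univ.filter (fun i => (p : ℤ) ∣ (f i).eval (s : ℤ))).card; let m : ℕ → ℝ := fun p => ∑ s
∈ Finset.range p, z ^ cnt p s; let V : ℕ → ℝ := fun x => ∏ p ∈ (Finset.range ⌊(x : ℝ) ^ θ⌋₊).filter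
Nat.Prime, ((p : ℝ) - Literature.NumberTheory.Sieve.polyRootCountMod f p) / m p; ∀ᶠ x : ℕ in atTop,
|Real.log x ^ k * (∑ n ∈ Finset.Icc 1 x, w n) * V x / (z ^ k * (x : ℝ)) -
Literature.NumberTheory.Sieve.batemanHornConst f / ∏ i, ((f i).natDegree : ℝ)| ≤ ε) ∧ (∀ (k : ℕ) (f
: Fin k → Polynomial ℤ), Literature.NumberTheory.Sieve.IsBatemanHornSystem f → ∀ θ : ℝ, 0 < θ → θ ≤
1 / 4 → ∀ ε : ℝ, 0 < ε → ∃ z₁ : ℝ, 0 < z₁ ∧ ∀ z : ℝ, 0 < z → z < z₁ → let w : ℕ → ℝ := fun n => z ^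
(∑ i, ArithmeticFunction.cardDistinctFactors (((f i).eval (n : ℤ)).toNat)); let A : ℕ → ℕ → ℕ → ℝ :=
fun x d r => ∑ n ∈ (Finset.Icc 1 x).filter (fun n : ℕ => n ≡ r [MOD d]), w n; let cnt : ℕ → ℕ → ℕ :=
fun p s => (Finset.univ.filter (fun i => (p : ℤ) ∣ (f i).eval (s : ℤ))).card; let m : ℕ → ℝ := fun p
=> ∑ s ∈ Finset.range p, z ^ cnt p s; let g : ℕ → ℕ → ℝ := fun d r => ∏ p ∈ d.primeFactors, z ^ cnt
p r / m p; let S : ℕ → ℕ → ℕ → ℝ := fun x d r => ∏ i, (1 - (∑ p ∈ d.primeFactors.filter (fun p : ℕ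
=> (p : ℤ) ∣ (f i).eval (r : ℤ)), Real.log p) / (((f i).natDegree : ℝ) * Real.log x)) ^ (z - 1); let
V : ℕ → ℝ := fun x => ∏ p ∈ (Finset.range ⌊(x : ℝ) ^ θ⌋₊).filter Nat.Prime, ((p : ℝ) -
Literature.NumberTheory.Sieve.polyRootCountMod f p) / m p; let R : ℕ → Finset ℕ := fun x =>
(Finset.Icc 1 x).filter (fun n : ℕ => ∀ i, ∀ p ∈ Finset.range ⌊(x : ℝ) ^ θ⌋₊, p.Prime → ¬ ((p : ℤ) ∣
(f i).eval (n : ℤ))); ((fun x : ℕ => ∑ d ∈ (Finset.Icc 1 ⌊(x : ℝ) ^ θ⌋₊).filter Squarefree, ∑ r ∈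
(Finset.range d).filter (fun r : ℕ => (d : ℤ) ∣ ∏ i, (f i).eval (r : ℤ)), |A x d r - g d r * S x d r
* ∑ n ∈ Finset.Icc 1 x, w n|) =o[atTop] fun x : ℕ => (∑ n ∈ Finset.Icc 1 x, w n) * V x) → ∀ᶠ x : ℕ
in atTop, |(∑ n ∈ R x, w n) - (∑ n ∈ Finset.Icc 1 x, w n) * V x| ≤ ε * ((∑ n ∈ Finset.Icc 1 x, w n)
* V x))`

## Assembly
Machine-checked (glue.lean = Sketch.lean `closes`, lean check rc 0, axioms standard): fix k, f,
IsBatemanHornSystem f; TiltedLevel gives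
θ, z₀ and the relative level statement for all z < z₀; for each ε, DimensionZeroSandwich at (θ, ε)
gives z₁ and, fed with the level statement
for z < min z₀ z₁, the eventual sandwich; PrimeCellExtraction applied to this family of sandwiches,
to TiltCalibration at θ and to
RoughTupleBound at θ yields BatemanHornAsymptotic f; quantified over (k, f) this is
Literature.NumberTheory.Sieve.BatemanHornConjecture =
_root_.BatemanHorn. Every crux and both supports are hypotheses of `closes` and all are used (the
Assembly item records the same implication; `closes` does not take it as a hypothesis).

Rationale: WHY THIS LINE. Mechanism (2001 tp/fractional-divisor-lift, brief + results.tex Thm A/A′/A_rel + cert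
paper; Iwaniec1980 Thm 1 (κ < 1/2 ⇒ β = 1);
FriedlanderIwaniecOperaDeCribro2010 §11.15 Thm 11.21 "sifting beyond the level by sacrificing part
of f(1); when κ ≥ 1/2 nothing is
available"; Maynard2023 §9 Q23 "lifts a_n of a_p reducing the sieve dimension"; Hooley's damping
r(n)2^(−ω*(n)), Acta Math. 127 (1971)
280–281): a multiplicative tilt of parameter z < 1/2 lowers the sieve dimension below 1/2, where
level = sifting range already gives a
positive lower bound, so the WHOLE arithmetic input is the distribution of a POSITIVE divisor-like
weight in progressions. Two things are
new here. (i) All systems, any degrees: sift each coordinate only to x^θ; rough non-prime-tuple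
survivors are DISCOUNTED by the tilt (extra
factor z) and counted crudely (Selberg, O_θ(x/(log x)^k)), never estimated — so no Type-I/II, no
boundary layer, no window beyond x is
needed, and θ > 0 is arbitrary. (ii) κ = kz → 0 AFTER x → ∞ turns 2001's lower bound (whose constant
→ 2C₂ as z,w → 0, their Thm A)
into the asymptotic with constant: F_κ(1), f_κ(1) = 1 + O(κ log log(1/κ)) (Buchstab + fundamental
lemma), provided the tilted mass is
calibrated (K2, a Wirsing1961/Selberg–Delange-type law along f whose integer case is elementary).
Imported: sieve theory of small dimension
(Iwaniec 1980, Opera Ch. 11), mean values of non-negative multiplicative functions (Wirsing1961,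
NairTenenbaum1998, Henriot2012,
FouvryTenenbaum2021 Thm 1.8 for linear members), no spectral/probabilistic reformulation. Versus the
12 open BatemanHorn routes: the parity
content is relocated neither into CANCELLATION of a Möbius tail (PolynomialMobius, LambertRoots and
the four slice routes), nor into a shape
law at every sieve depth u with a thin semiprime layer (RoughValueTransport), parity balance at
infinite depth (RoughParitySectors),
complex-tilt normality / zero repulsion with Vitali (SelbergDelangeRigidity, AlmostPrimeZeros) or
histogram ratios (RatioProfile), but into
relative EQUIDISTRIBUTION of a positive tilted host among root classes of small moduli d < x^θ:
after the expansion
z^ω(m) = Σ_(e|m) μ(e)(1−z)^ω(e), K1 asks the damped Möbius large-divisor tail to be equidistributed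
among classes (precision (log x)^(−2κ)),
not to cancel; its λ(d)-incoherent part is exactly where Selberg's twisted host 1+λ(∏f_i(n)) fails
K1, at the critical order. Negatives
index (3, all GHL-side) untouched.

RANKED CRUXES. #2 TiltedLevel (crux) — For every Bateman–Horn system f there are θ ∈ (0,1/4] and z₀
> 0 such that for every tilt 0 < z < z₀ the tilted host w(n) = z^(Σ_i ω(f_i(n))) is distributed
among the root classes r mod d (d ≤ x^θ squarefree, d | ∏f_i(r)) according to the exact local factor
g(d,r) and the size law S(x;d,r) = ∏_i (1 − (Σ_(p|d, p|f_i(r)) log p)/(deg f_i·log x))^(z−1),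
RELATIVELY to the total mass and in ℓ¹: Σ_(d,r) |A(x;d,r) − g(d,r)S(x;d,r)A₁(x)| = o(A₁(x)V(x)),
V(x) = ∏_(p<x^θ) (p − ρ_F(p))/m_p (2001's W_rel, re-typed along f; the tilted analogue of 'one
singular-series model governs every sieve class relative to d = 1'). [difficulty: open-problem] (why
it might fail: needs relative precision o((log x)^(-2κ)) in ℓ¹(g): its fixed-modulus case is a
tilted 'rung 3(ii)' along f (2001 cert: open even for twins, beyond every P-blind method); the size
law S may be off at 2nd order for polynomial values; λ(d)-incoherent biases must be o(z).)
[FouvryTenenbaum2021, Iwaniec1980, Henriot2012, NairTenenbaum1998, DukeFriedlanderIwaniec1995,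
Toth2000, Hooley1964, Ford2004, Maynard2023]
#3 TiltCalibration (crux) — For every system f, every θ ∈ (0,1/4] and ε > 0 there is z₂ > 0 such
that for 0 < z < z₂, eventually in x, |(log x)^k · A₁(x) · V(x) / (z^k x) − C(f)/∏_i deg f_i| ≤ ε,
where A₁(x) = Σ_(n≤x) z^(Σ_i ω(f_i(n))) is the tilted mass, V the sifted density of K1 and C(f) =
batemanHornConst f: the z → 0⁺ germ of the tilted Wirsing/Selberg–Delange law along f is the
singular series (for f = (X) this is Wirsing's theorem + Mertens; given K1, K3 and the supports it
is EQUIVALENT to BatemanHornAsymptotic f, so it is the 'main-term' half of the line). [difficulty: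
open-problem] (why it might fail: for fixed z the tilted mass along polynomial values has only its
ORDER known (Nair–Tenenbaum/Henriot); the germ needs limsup = liminf as z→0, i.e. no persistent
oscillation of π_f(x)(log x)^k/x (it is BH-strength given K1) and the large-prime anatomy of f(n)
entering c_f(z)/z → C(f).) [Wirsing1961, Tenenbaum2015, Selberg1954, NairTenenbaum1998, Henriot2012,
BatemanHornMathComp1962]
#4 DimensionZeroSandwich (crux) — (unpublished internal dependency, declared as a crux) For every
system f, θ ∈ (0,1/4], ε > 0 there is z₁ > 0 such that for 0 < z < z₁: IF the relative level
hypothesis of K1 holds at (θ, z), THEN eventually |Σ_(n ≤ x, all f_i(n) x^θ-rough) w(n) − A₁(x)V(x)|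
≤ ε·A₁(x)V(x) — the β-sieve lower bound and the Buchstab/fundamental-lemma upper bound at s = 1
(sifting range = level = x^θ) in dimension κ ≍ kz, with F_κ(1), f_κ(1) = 1 + O(κ log log(1/κ)) and
the size law S carried through the main term (its Taylor coefficients in log d/log x are ≥ 0, so Σ_d
λ_d g(d)S_d is an average of honest sieve main terms for the densities g(d)d^(−u/log x)). 2001
proved the LOWER half for the twin host at fixed κ ≤ 1/5 and any level x^θ (results.tex Thm A/A′,
relative form Thm A_rel; refereed in-programme 2026-08-08, Lean TpFdlThmA.lean GREEN with 9
interface assumptions); the two-sided κ → 0 form for all systems is not in print. [deps: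
TiltedLevel] [difficulty: L] (why it might fail: the size factor S(x;d,r) is only
quasi-multiplicative; carrying it through the β-sieve main term at s = 1 with relative error o((log
x)^(-2κ)) is unwritten (2001 human ruling: the one-sided dimension is z·2^(1−z)+…, not κ, at level
1/2 — here θ ≤ 1/4 and deg ≥ 1 keep the distortion ≤ (4/3)^(1−z)).) [Iwaniec1980,
FriedlanderIwaniecOperaDeCribro2010, HalberstamRichert1974, Greaves2001, FouvryTenenbaum2021]
#9 RoughTupleBound (support) — For every system f and θ ∈ (0,1/4] there is C with #{n ≤ x : no prime
p < x^θ divides any f_i(n)} ≤ C·x/(log x)^k eventually (Selberg / β upper-bound sieve of dimension k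
on the product sequence at level x^θ; Bateman–Horn 1962 (2) is the case θ = 1/2; Halberstam–Richert
Thm 5.3). In the tree: BetaSieve.sum_weights_le / indicator_le_sum_weights and
SieveSequence.fundamental_lemma_uniform_holds give it with C ≍ C(f)θ^(−k). [difficulty: M]
[BatemanHornMathComp1962, HalberstamRichert1974, Greaves2001]
#9 PrimeCellExtraction (support) — (provable now: real analysis + bookkeeping) For a system f and θ
∈ (0,1/4]: if for every ε there is z₁ with the sandwich |Σ_(rough) w − A₁V| ≤ εA₁V for all 0 < z <
z₁ (eventually in x), if the calibration of K2 holds at θ, and if the rough tuples number ≤ Cx/(log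
x)^k, then BatemanHornAsymptotic f. Proof: for n ≥ n₀(f), an x^θ-rough n has w(n) = z^k exactly when
every f_i(n) is prime and w(n) ≤ z^(k+1) otherwise (some coordinate has ω ≥ 2), while prime tuples
with some f_i(n) < x^θ are O(x^θ); hence z^k π_f(x) − O(x^θ) ≤ Σ_(rough) w ≤ z^k (π_f(x) + z·C
x/(log x)^k); divide by z^k x/(log x)^k, insert the sandwich and the calibration, let x → ∞ then z →
0 (ε-management), and use HasBatemanHornConst f (batemanHornConst f) from the PROVED
IsBatemanHornSystem.hasBatemanHornConst_holds. [difficulty: provable-now] [BatemanHornMathComp1962,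
Iwaniec1980]

TWO-LAYER PLAN. TiltedLevel ⇐ SmallModuli (d ≤ exp(√log x): relative local equidistribution of the
tilted host among root classes of small moduli — the
tilted 'rung 3(ii)' along f, size law 1 + o(1)) → LevelRange (exp(√log x) < d ≤ x^θ: the
Bombieri–Vinogradov-type part, where S bites) →
TiltedLevel (range split; PROVED as bc/TiltedLevel_birth.lean `TiltedLevel_of`). TiltCalibration ⇐
TiltedMassLimit (for each small z the
calibrated tilted mass converges: the tilted Wirsing law along f) → TiltGerm (the limits tend to
C(f)/∏deg as z → 0⁺) → TiltCalibration
(PROVED, bc/TiltCalibration_birth.lean). DimensionZeroSandwich ⇐ LowerHalf (β-sieve, 2001 Thm A_rel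
generalised) → UpperHalf (Buchstab +
fundamental lemma, F_κ(1) → 1) → DimensionZeroSandwich (PROVED,
bc/DimensionZeroSandwich_birth.lean). A further foreseen split of
LevelRange by the h-expansion A(x;d,r) = Σ_e μ(e)(1−z)^ω(e)·N(x;d,r,e): Type-I range (exact), window
e ∈ (x^(1−2θ), x^(1+δ)] (μ-damped joint
equidistribution of roots of f mod e in position × residue mod d: DFI/Tóth/Hooley grade in degree
2), deep range (relative equidistribution
mod d of the damped Möbius of the large cofactor). Nothing filed now.

KILL CRITERIA. refuted:TiltedLevel by a certified divergence of the model (e.g. the per-class ratios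
A(x;p,r)/(g(p,r)A₁(x)) drifting away from the size law
(1 − log p/(deg·log x))^(z−1) beyond O(1/log x), or an analytic proof that the size law is wrong at
relative order ≫ (log x)^(−2κ) for some
system) forces ONE restatement with the corrected explicit size law (the frame survives any S with
non-negative Taylor coefficients); a
refutation of the RELATIVE equidistribution itself (a system whose tilted host is provably biased
among root classes at order (log x)^(−2κ))
closes the route outright. refuted:TiltCalibration with K1 standing refutes BatemanHornAsymptotic
for that f up to the theorem-grade K3 and
supports — close the route and flag the conjunct. refuted:DimensionZeroSandwich (a host satisfying
K1 whose sifted tilted mass is not A₁V(1+o_z(1)))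
means my sieve bookkeeping of the size factor is wrong ⇒ pivot (re-derive the main term), do not
close. A proof of BatemanHorn elsewhere moots it.

NOT DECOMPOSED YET. The h-expansion split of TiltedLevel into Type-I / window / deep ranges (layer
2, after a prover reports on SmallModuli); the explicit
admissible one-sided dimension κ'(z,θ,f) and the constants in F_κ(1) − f_κ(1); uniformity in θ (none
claimed: θ ≤ 1/4 fixed per system);
the k = 1 linear instance of the whole chain (K1 = Fouvry–Tenenbaum Thm 1.8 / Wolke, K2 = Wirsing +
Mertens, K3, K4 ⇒ PNT-strength
statement) as a provable calibration target; mixed systems need nothing extra (the size distortion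
of a linear member at level x^θ is
(1−θ)^(z−1) ≤ (4/3)^(1−z)). All are layer-2 children or prover-side lemmas (--supports).

CHEAPEST FALSIFIER. Run here (numerics/tilt_nsq1.py, f = X²+1, x = 3·10⁵, 10⁶, 10⁷; out_1e6.txt,
out_1e7.txt): (i) sandwich Σ_rough w/(A₁V) =
0.9936 / 0.9883 / 0.9805 at z = 0.05 / 0.1 / 0.2 (x = 10⁷, θ = 1/4): 1 − ratio ≈ 0.12·z, linear in z
as K3 predicts; (ii) K1 model at
x = 10⁷, z = 0.1: per-class ratios A(x;p,r)/(g(p,r)A₁) = 1.0199 (p = 2) vs size law 1.0198; 1.061 vs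
1.047 (p = 5); 1.091 vs 1.078 (13);
1.120 vs 1.104 (29) — exact local factor confirmed at p = 2 to 10⁻⁴, residual over the size law
shrank from ≈2.0% (10⁶) to ≈1.3% (10⁷),
consistent with O(1/log x); with S ≡ 1 the ℓ¹ deviation is 7× larger (0.0150 vs 0.0021); (iii) the
prime cell carries zπ_f/(A₁V) =
0.909 / 0.830 / 0.700 of the sifted tilted mass (z = 0.05/0.1/0.2), identical at 10⁶ and 10⁷.
Cheapest kill for a refuter: the same
script at 10⁸–10⁹ (kit) — a per-class residual that STOPS shrinking, or a drift in x of zπ_f/(A₁V)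
at fixed z, falsifies the size law
resp. the frame; second: verify analytically that Selberg's twisted host w(n)(1+λ(∏f_i(n))) violates
K1 at order exactly
(log x)^(−2κ)·A₁Σg (it must, else the frame would prove BH for a prime-free host).

NUMBERS. κ-dependence: Iwaniec1980 (2.2): f_κ(1) = B_κ > 0 for κ < 1/2 (B_(1/4) = 0.8636, B_(0.4) =
0.5154, B_(0.44) = 0.3495 — 2001 DDE-checked);
here only F_κ(1), f_κ(1) → 1 as κ → 0 is used. 2001 (twins, z = w): Thm A constant 2S(1)T(z,w)(m(κ)
− e(z,w)) → 2C₂ as z,w → 0; pure β = 1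
lower sieve at s = 1 on the TRUE A_d captures 0.894 (z = w = 0.1) / 0.962 (1/16) of S(c;√x) at x =
10⁷; their FBD remainder ratio
R(√x)/(M₁V) = 0.070, 0.060, 0.034 at x = 10⁵, 10⁶, 10⁷ (z = w = 1/8). This route, f = X²+1: C(f)/deg
= 𝔖/2 = 0.68641 (𝔖 = 1.3728135),
π_f(x)·log x/x = 0.7505 / 0.7460 / 0.7351 at x = 3·10⁵ / 10⁶ / 10⁷; Φ_x(z) := log x·A₁V/(zx) = 0.809
(z = 0.05), 0.885 (0.1), 1.050 (0.2) at
x = 10⁷, i.e. Φ_x(z) = (π_f log x/x)·c(z) with c(z) = 1.10, 1.20, 1.43 → 1 as z → 0 (K2 ⟺ BH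
structure visible). Level: any θ > 0 (filed
θ ≤ 1/4); sifting range = level (s = 1); precision demanded by K1: o((log x)^(−2κ)) in ℓ¹(g), κ ≍
kz.

DEFINITION REQUESTS. None: w, A, g, m_p, S, V, the root classes and the rough set are finite
expressions over Finset.Icc/range with
ArithmeticFunction.cardDistinctFactors, Literature.NumberTheory.Sieve.polyRootCountMod,
batemanHornConst, Real.log/rpow, inlined as `let`s
(Sketch.lean rc 0). Cite facts wanted later (not blocking): Iwaniec 1980 Thm 1 (β-sieve main theorem
with one-sided dimension condition,
κ < 1/2 ⇒ β = 1) and Fouvry–Tenenbaum Thm 1.8 for τ_z / z^ω (the k = 1 linear instance of K1) as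
Literature facts.

Novelty: Searches (2026-08-17): local `lit search` tier DOWN all session (searchd ConnectionResetError ×4;
OpenAlex/S2 rate-limited 429) — grader
please re-run `lit search --hybrid "sieve of dimension less than one half prime values of
polynomials"`; run instead: `lit search --source
zbmath` ×9 ("Rosser's sieve Iwaniec dimension": 7 hits — Iwaniec 1980 doi:10.4064/aa-36-2-171-202,
'Sieving limits' 1981, Greaves 2001,
Coleman 1993 number fields; "sieve small dimension prime polynomial": 4 — Irving arXiv:1410.3333
almost-prime values at prime arguments,
Menconi–Paredes–Sasyk inverse sieve arXiv:1907.02049; "multiplicative functions polynomial values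
mean value" / "sums of multiplicative
functions over values of polynomials": Nair 1992 doi:10.4064/aa-62-3-257-269 (upper bounds in short
intervals), de la Bretèche–Browning
arXiv:math/0604119 (binary forms), de la Bretèche–Tenenbaum arXiv:2403.19320; "number of prime
factors of polynomial values local
distribution": Tenenbaum 2018 arXiv:1710.04877 (conjoint local laws, upper bounds only), Maynard
arXiv:1507.05080; three further queries 0
hits); `lit galaxy search --star all` ×3 ("sieve of dimension less than": 0; "reducing the sieve
dimension": 0; "half dimensional sieve":
11 — Diamond–Halberstam–Galway book, Greaves' book, BFI Acta Math 1986, Baier–Zhao primes in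
quadratic progressions on average); `lean
search` (TiltedLevel/TiltCalibration/DimensionZeroSandwich: no Parity decl; tree has
FouvryTenenbaumLiouville (Thm 1.8 for λ), BetaSieve*  [refs: 10.4064/aa-36-2-171-202, 10.4064/aa-62-3-257-269, 1410.3333, 1907.02049, math/0604119, 2403.19320, 1710.04877, 1507.05080, 1609.01411, 1807.09569, 2004.04766, doi:10.4064/aa-36-2-171-202, doi:10.4064/aa-62-3-257-269, Iwaniec1980, FriedlanderIwaniecOperaDeCribro2010, Maynard2023, Wirsing1961]

Barriers (technique_class: small-dimension-sieve, tilted-host, relative-level): - technique_class: small-dimension-sieve, tilted-host, relative-level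
- Literature.Barriers.Parity.SelbergParityBarrier: it does not evade it; the bet is explicit —
Selberg's twisted host w(n)(1 + λ(∏f_i(n))) has the same order of magnitude in every class but
violates TiltedLevel at exactly the critical order (its class deviations are λ(d)-signed of relative
size ≍ (log x)^(−2κ), summing in ℓ¹(g) to ≍ A₁V, not o(A₁V)), so K1 is where the parity bit is paid,
as positive-weight relative equidistribution at precision (log x)^(−2κ); no functional of Type-I
data of the 0/1 value sequence is used (the barrier's no_typeI_prime_lower_bound_allModuli concerns
dimension-1 data A_d(x) of the prime-carrying sequence, not class masses of a dimension-κ tilt).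
- Literature.Barriers.Parity.FordFixedLevelBarrier: scope — Ford's witnesses are dimension-1 hosts
(A(x) = x, g(d) = 1/d) at fixed level ν < 1 for Bombieri's Λ_k-sieve; here the fixed level x^θ feeds
a dimension-κ → 0 sieve on a tilted host, whose hypothesis K1 Ford's sequences (built from λ-twisted
blocks) do not satisfy; the barrier explains why K1 cannot be weakened to untilted Type-I data at
any level.
- Literature.Barriers.Parity.WeightedSieveLimit: not engaged — Greaves' Λ_R ≤ R is for
Proposition-5.1-shaped theorems (dimension-1 density ρ(d)/d, degree g, level D) and kills P_g from
such data; the κ < 1/2 sieve at s = 1 is outside that shape (Opera §11.15: positive f(1) to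
sacrifice exists only for κ < 1/2), and primality is ext

History (route lifecycle, newest last):
- 2026-08-24T11:40:57Z · DORMANT — reconciler: no traction for 6.7 d (last activity item-evidence-added at 2026-08-17T17:10:06Z); parked, not closed — `ledger route dormant route-Parity-Vanishing (operator:999:3181444)

sub-problem: BatemanHorn · status: dormant · opened planner-plan-lens3-Parity-resurrect-g2-0 2026-08-17T02:47:52Z · rev 2 · ledger route-Parity-VanishingDimension
GENERATED by the gate from the ledger (D-0016/17). Provers cite these decls: `theorem foo : Summit.Parity.BatemanHorn.Theses.VanishingDimension.<Decl> := …` in Summits/Parity/BatemanHorn/Theorems/<Name>.lean.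
-/

namespace Summit.Parity.BatemanHorn.Theses.VanishingDimension

open scoped BigOperators Topology Manifold Classical MeasureTheory ProbabilityTheory Matrix InnerProductSpace ComplexConjugate ContinuousMap
open Filter Set Function TopologicalSpace MeasureTheory

attribute [summit_statement] _root_.BatemanHorn

/-- item stmt-Parity-18603 · crux · rank 2 · open · by planner
why it might fail: needs relative precision o((log x)^(-2κ)) in ℓ¹(g): its fixed-modulus case is a tilted 'rung 3(ii)' along f (2001 cert: open even for twins, beyond every P-blind method); the size law S may be off at 2nd order for polynomial values; λ(d)-incoherent biases must be o(z).
sources: FouvryTenenbaum2021, Iwaniec1980, Henriot2012, NairTenenbaum1998, DukeFriedlanderIwaniec1995, Toth2000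
[crux] For every Bateman–Horn system f there are θ ∈ (0,1/4] and z₀ > 0 such that for every tilt 0 <
z < z₀ the tilted host w(n) = z^(Σ_i ω(f_i(n))) is distributed among the root classes r mod d (d ≤
x^θ squarefree, d | ∏f_i(r)) according to the exact local factor g(d,r) and the size law S(x;d,r) =
∏_i (1 − (Σ_(p|d, p|f_i(r)) log p)/(deg f_i·log x))^(z−1), RELATIVELY to the total mass and in ℓ¹:
Σ_(d,r) |A(x;d,r) − g(d,r)S(x;d,r)A₁(x)| = o(A₁(x)V(x)), V(x) = ∏_(p<x^θ) (p − ρ_F(p))/m_p (2001's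
W_rel, re-typed along f; the tilted analogue of 'one singular-series model governs every sieve class
relative to d = 1'). [difficulty: open-problem] -/
@[route_item "route-Parity-VanishingDimension", crux]
def TiltedLevel : Prop :=
  ∀ (k : ℕ) (f : Fin k → Polynomial ℤ), Literature.NumberTheory.Sieve.IsBatemanHornSystem f → ∃ θ : ℝ, 0 < θ ∧ θ ≤ 1 / 4 ∧ ∃ z₀ : ℝ, 0 < z₀ ∧ ∀ z : ℝ, 0 < z → z < z₀ → let w : ℕ → ℝ := fun n => z ^ (∑ i, ArithmeticFunction.cardDistinctFactors (((f i).eval (n : ℤ)).toNat)); let A : ℕ → ℕ → ℕ → ℝ := fun x d r => ∑ n ∈ (Finset.Icc 1 x).filter (fun n : ℕ => n ≡ r [MOD d]), w n; let cnt : ℕ → ℕ → ℕ := fun p s => (Finset.univ.filter (fun i => (p : ℤ) ∣ (f i).eval (s : ℤ))).card; let m : ℕ → ℝ := fun p => ∑ s ∈ Finset.range p, z ^ cnt p s; let g : ℕ → ℕ → ℝ := fun d r => ∏ p ∈ d.primeFactors, z ^ cnt p r / m p; let S : ℕ → ℕ → ℕ → ℝ := fun x d r => ∏ i, (1 - (∑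 p ∈ d.primeFactors.filter (fun p : ℕ => (p : ℤ) ∣ (f i).eval (r : ℤ)), Real.log p) / (((f i).natDegree : ℝ) * Real.log x)) ^ (z - 1); let V : ℕ → ℝ := fun x => ∏ p ∈ (Finset.range ⌊(x : ℝ) ^ θ⌋₊).filter Nat.Prime, ((p : ℝ) - Literature.NumberTheory.Sieve.polyRootCountMod f p) / m p; (fun x : ℕ => ∑ d ∈ (Finset.Icc 1 ⌊(x : ℝ) ^ θ⌋₊).filter Squarefree, ∑ r ∈ (Finset.range d).filter (fun r : ℕ => (d : ℤ) ∣ ∏ i, (f i).eval (r : ℤ)), |A x d r - g d r * S x d r * ∑ n ∈ Finset.Icc 1 x, w n|) =o[atTop] fun x : ℕ => (∑ n ∈ Finset.Icc 1 x, w n) * V x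

/-- item stmt-Parity-18604 · crux · rank 3 · open · by planner
why it might fail: for fixed z the tilted mass along polynomial values has only its ORDER known (Nair–Tenenbaum/Henriot); the germ needs limsup = liminf as z→0, i.e. no persistent oscillation of π_f(x)(log x)^k/x (it is BH-strength given K1) and the large-prime anatomy of f(n) entering c_f(z)/z → C(f).
sources: Wirsing1961, Tenenbaum2015, Selberg1954, NairTenenbaum1998, Henriot2012, BatemanHornMathComp1962
[crux] For every system f, every θ ∈ (0,1/4] and ε > 0 there is z₂ > 0 such that for 0 < z < z₂,
eventually in x, |(log x)^k · A₁(x) · V(x) / (z^k x) − C(f)/∏_i deg f_i| ≤ ε, where A₁(x) = Σ_(n≤x)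
z^(Σ_i ω(f_i(n))) is the tilted mass, V the sifted density of K1 and C(f) = batemanHornConst f: the
z → 0⁺ germ of the tilted Wirsing/Selberg–Delange law along f is the singular series (for f = (X)
this is Wirsing's theorem + Mertens; given K1, K3 and the supports it is EQUIVALENT to
BatemanHornAsymptotic f, so it is the 'main-term' half of the line). [difficulty: open-problem] -/
@[route_item "route-Parity-VanishingDimension", crux]
def TiltCalibration : Prop :=
  ∀ (k : ℕ) (f : Fin k → Polynomial ℤ), Literature.NumberTheory.Sieve.IsBatemanHornSystem f → ∀ θ : ℝ, 0 < θ → θ ≤ 1 / 4 → ∀ ε : ℝ, 0 < ε → ∃ z₂ : ℝ, 0 < z₂ ∧ ∀ z : ℝ, 0 < z → z < z₂ → let w : ℕ → ℝ := fun n => z ^ (∑ i, ArithmeticFunction.cardDistinctFactors (((f i).eval (n : ℤ)).toNat)); let cnt : ℕ → ℕ → ℕ := fun p s => (Finset.univ.filter (fun i => (p : ℤ) ∣ (f i).eval (s : ℤ))).card; let m : ℕ → ℝ := fun p => ∑ s ∈ Finset.range p, z ^ cnt p s; let V : ℕ → ℝ := fun x => ∏ p ∈ (Finset.range ⌊(x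 : ℝ) ^ θ⌋₊).filter Nat.Prime, ((p : ℝ) - Literature.NumberTheory.Sieve.polyRootCountMod f p) / m p; ∀ᶠ x : ℕ in atTop, |Real.log x ^ k * (∑ n ∈ Finset.Icc 1 x, w n) * V x / (z ^ k * (x : ℝ)) - Literature.NumberTheory.Sieve.batemanHornConst f / ∏ i, ((f i).natDegree : ℝ)| ≤ ε

/-- item stmt-Parity-18605 · crux · rank 4 · open · by planner
why it might fail: the size factor S(x;d,r) is only quasi-multiplicative; carrying it through the β-sieve main term at s = 1 with relative error o((log x)^(-2κ)) is unwritten (2001 human ruling: the one-sided dimension is z·2^(1−z)+…, not κ, at level 1/2 — here θ ≤ 1/4 and deg ≥ 1 keep the distortion ≤ (4/3)^(1−z)).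
sources: Iwaniec1980, FriedlanderIwaniecOperaDeCribro2010, HalberstamRichert1974, Greaves2001, FouvryTenenbaum2021
[crux] (unpublished internal dependency, declared as a crux) For every system f, θ ∈ (0,1/4], ε > 0
there is z₁ > 0 such that for 0 < z < z₁: IF the relative level hypothesis of K1 holds at (θ, z),
THEN eventually |Σ_(n ≤ x, all f_i(n) x^θ-rough) w(n) − A₁(x)V(x)| ≤ ε·A₁(x)V(x) — the β-sieve lower
bound and the Buchstab/fundamental-lemma upper bound at s = 1 (sifting range = level = x^θ) in
dimension κ ≍ kz, with F_κ(1), f_κ(1) = 1 + O(κ log log(1/κ)) and the size law S carried through the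
main term (its Taylor coefficients in log d/log x are ≥ 0, so Σ_d λ_d g(d)S_d is an average of
honest sieve main terms for the densities g(d)d^(−u/log x)). 2001 proved the LOWER half for the twin
host at fixed κ ≤ 1/5 and any level x^θ (results.tex Thm A/A′, relative form Thm A_rel; refereed
in-programme 2026-08-08, Lean TpFdlThmA.lean GREEN with 9 interface assumptions); the two-sided κ →
0 form for all systems is not in print. [deps: TiltedLevel] [difficulty: L] -/
@[route_item "route-Parity-VanishingDimension", crux]
def DimensionZeroSandwich : Prop :=
  ∀ (k : ℕ) (f : Fin k → Polynomial ℤ), Literature.NumberTheory.Sieve.IsBatemanHornSystem f → ∀ θ : ℝ, 0 < θ → θ ≤ 1 / 4 → ∀ ε : ℝ, 0 < ε → ∃ z₁ : ℝ, 0 < z₁ ∧ ∀ z : ℝ, 0 < z → z < z₁ → let w : ℕ → ℝ := fun n => z ^ (∑ i, ArithmeticFunction.cardDistinctFactors (((f i).eval (n : ℤ)).toNat)); let A : ℕ → ℕ → ℕ → ℝ := fun x d r => ∑ n ∈ (Finset.Icc 1 x).filter (fun n : ℕ => n ≡ r [MOD d]), w n; let cnt : ℕ → ℕ → ℕ :=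 fun p s => (Finset.univ.filter (fun i => (p : ℤ) ∣ (f i).eval (s : ℤ))).card; let m : ℕ → ℝ := fun p => ∑ s ∈ Finset.range p, z ^ cnt p s; let g : ℕ → ℕ → ℝ := fun d r => ∏ p ∈ d.primeFactors, z ^ cnt p r / m p; let S : ℕ → ℕ → ℕ → ℝ := fun x d r => ∏ i, (1 - (∑ p ∈ d.primeFactors.filter (fun p : ℕ => (p : ℤ) ∣ (f i).eval (r : ℤ)), Real.log p) / (((f i).natDegree : ℝ) * Real.log x)) ^ (z - 1); let V : ℕ → ℝ := fun x => ∏ p ∈ (Finset.range ⌊(x : ℝ) ^ θ⌋₊).filter Nat.Prime, ((p : ℝ) - Literature.NumberTheory.Sieve.polyRootCountMod f p) / m p; let R : ℕ → Finset ℕ := fun x => (Finset.Icc 1 x).filter (fun n : ℕ => ∀ i, ∀ p ∈ Finset.range ⌊(x : ℝ) ^ θ⌋₊, p.Prime → ¬ ((p : ℤ) ∣ (f i).eval (n : ℤ))); ((fun x : ℕ => ∑ d ∈ (Finset.Icc 1 ⌊(x : ℝ) ^ θ⌋₊).filter Squarefree, ∑ r ∈ (Finset.range d).filter (fun r : ℕ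 => (d : ℤ) ∣ ∏ i, (f i).eval (r : ℤ)), |A x d r - g d r * S x d r * ∑ n ∈ Finset.Icc 1 x, w n|) =o[atTop] fun x : ℕ => (∑ n ∈ Finset.Icc 1 x, w n) * V x) → ∀ᶠ x : ℕ in atTop, |(∑ n ∈ R x, w n) - (∑ n ∈ Finset.Icc 1 x, w n) * V x| ≤ ε * ((∑ n ∈ Finset.Icc 1 x, w n) * V x)

/-- item stmt-Parity-18606 · support · rank 9 · closed · proved by Summit.Parity.BatemanHorn.Theorems.vanishingDimension_roughTupleBound_proof @ 274f8a6816c2 (prover) · by planner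
sources: BatemanHornMathComp1962, HalberstamRichert1974, Greaves2001
[support] For every system f and θ ∈ (0,1/4] there is C with #{n ≤ x : no prime p < x^θ divides any
f_i(n)} ≤ C·x/(log x)^k eventually (Selberg / β upper-bound sieve of dimension k on the product
sequence at level x^θ; Bateman–Horn 1962 (2) is the case θ = 1/2; Halberstam–Richert Thm 5.3). In
the tree: BetaSieve.sum_weights_le / indicator_le_sum_weights and
SieveSequence.fundamental_lemma_uniform_holds give it with C ≍ C(f)θ^(−k). [difficulty: M] -/
@[route_item "route-Parity-VanishingDimension", crux]
def RoughTupleBound : Prop :=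
  ∀ (k : ℕ) (f : Fin k → Polynomial ℤ), Literature.NumberTheory.Sieve.IsBatemanHornSystem f → ∀ θ : ℝ, 0 < θ → θ ≤ 1 / 4 → ∃ C : ℝ, ∀ᶠ x : ℕ in atTop, ((((Finset.Icc 1 x).filter (fun n : ℕ => ∀ i, ∀ p ∈ Finset.range ⌊(x : ℝ) ^ θ⌋₊, p.Prime → ¬ ((p : ℤ) ∣ (f i).eval (n : ℤ)))).card : ℕ) : ℝ) ≤ C * (x : ℝ) / Real.log x ^ k

/-- item stmt-Parity-18607 · support · rank 9 · closed · proved by Summit.Parity.BatemanHorn.Theorems.PrimeCellExtraction.primeCellExtraction_proof @ 5febcc06f295 (prover) · by planner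
sources: BatemanHornMathComp1962, Iwaniec1980
[support] (provable now: real analysis + bookkeeping) For a system f and θ ∈ (0,1/4]: if for every ε
there is z₁ with the sandwich |Σ_(rough) w − A₁V| ≤ εA₁V for all 0 < z < z₁ (eventually in x), if
the calibration of K2 holds at θ, and if the rough tuples number ≤ Cx/(log x)^k, then
BatemanHornAsymptotic f. Proof: for n ≥ n₀(f), an x^θ-rough n has w(n) = z^k exactly when every
f_i(n) is prime and w(n) ≤ z^(k+1) otherwise (some coordinate has ω ≥ 2), while prime tuples with
some f_i(n) < x^θ are O(x^θ); hence z^k π_f(x) − O(x^θ) ≤ Σ_(rough) w ≤ z^k (π_f(x) + z·C x/(log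
x)^k); divide by z^k x/(log x)^k, insert the sandwich and the calibration, let x → ∞ then z → 0
(ε-management), and use HasBatemanHornConst f (batemanHornConst f) from the PROVED
IsBatemanHornSystem.hasBatemanHornConst_holds. [difficulty: provable-now] -/
@[route_item "route-Parity-VanishingDimension", crux]
def PrimeCellExtraction : Prop :=
  ∀ (k : ℕ) (f : Fin k → Polynomial ℤ), Literature.NumberTheory.Sieve.IsBatemanHornSystem f → ∀ θ : ℝ, 0 < θ → θ ≤ 1 / 4 → let w : ℝ → ℕ → ℝ := fun z n => z ^ (∑ i, ArithmeticFunction.cardDistinctFactors (((f i).eval (n : ℤ)).toNat)); let cnt : ℕ → ℕ → ℕ := fun p s => (Finset.univ.filter (fun i => (p : ℤ) ∣ (f i).eval (s : ℤ))).card; let m : ℝ → ℕ → ℝ := fun z p => ∑ s ∈ Finset.range p, z ^ cnt p s; let V : ℝ → ℕ → ℝ := fun z x => ∏ p ∈ (Finset.range ⌊(x : ℝ) ^ θ⌋₊).filter Nat.Prime, ((p : ℝ) - Literature.NumberTheory.Sieve.polyRootCountMod f p) / m z p; let R : ℕ → Finset ℕ := fun x => (Finset.Icc 1 x).filter (fun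 n : ℕ => ∀ i, ∀ p ∈ Finset.range ⌊(x : ℝ) ^ θ⌋₊, p.Prime → ¬ ((p : ℤ) ∣ (f i).eval (n : ℤ))); (∀ ε : ℝ, 0 < ε → ∃ z₁ : ℝ, 0 < z₁ ∧ ∀ z : ℝ, 0 < z → z < z₁ → ∀ᶠ x : ℕ in atTop, |(∑ n ∈ R x, w z n) - (∑ n ∈ Finset.Icc 1 x, w z n) * V z x| ≤ ε * ((∑ n ∈ Finset.Icc 1 x, w z n) * V z x)) → (∀ ε : ℝ, 0 < ε → ∃ z₂ : ℝ, 0 < z₂ ∧ ∀ z : ℝ, 0 < z → z < z₂ → ∀ᶠ x : ℕ in atTop, |Real.log x ^ k * (∑ n ∈ Finset.Icc 1 x, w z n) * V z x / (z ^ k * (x : ℝ)) - Literature.NumberTheory.Sieve.batemanHornConst f / ∏ i, ((f i).natDegree : ℝ)| ≤ ε) → (∃ C : ℝ, ∀ᶠ x : ℕ in atTop, (((R x).card : ℕ) : ℝ) ≤ C * (x : ℝ) / Real.log x ^ k) → Literature.NumberTheory.Sieve.BatemanHornAsymptotic f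

/-- item stmt-Parity-18608 · assembly · rank 1 · closed · proved by Summit.Parity.BatemanHorn.Theorems.vanishingDimension_assembly_proof @ bcd9ef854758 (prover) · by planner
sources: Iwaniec1980, BatemanHornMathComp1962
[assembly] TiltedLevel → TiltCalibration → DimensionZeroSandwich → RoughTupleBound →
PrimeCellExtraction → BatemanHorn (the implication proved by `closes`; filed because the schema
requires one assembly item — it is not a hypothesis of `closes`). -/
@[route_item "route-Parity-VanishingDimension"]
def Assembly : Prop :=
  TiltedLevel → TiltCalibration → DimensionZeroSandwich → RoughTupleBound → PrimeCellExtraction → _root_.BatemanHorn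

/-! D-0027 §2.1 — DECIDING THEOREM (planner-authored via `route open/edit --closes-file`; by planner-plan-lens3-Parity-resurrect-g2-0 2026-08-17T02:47:52Z):
its hypotheses are this route's items and its conclusion the sub-problem Statement (glue_lint), and it elaborates with this file. -/

/-- D-0027 §2.1 deciding theorem of route VanishingDimension: the three cruxes `TiltedLevel` (r2),
`TiltCalibration` (r3), `DimensionZeroSandwich` (r4) and the two supports `RoughTupleBound`,
`PrimeCellExtraction` imply the sub-problem statement `BatemanHorn`
(= `Literature.NumberTheory.Sieve.BatemanHornConjecture`). Proof: fix a system; `TiltedLevel` gives a level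
exponent θ and a tilt threshold z₀; for every ε the sandwich `DimensionZeroSandwich` at (θ, ε) gives z₁, and for
z < min z₀ z₁ the relative level hypothesis feeds it, so the tilted mass of the jointly x^θ-rough values is
A₁V(1 ± ε) eventually; `PrimeCellExtraction` combines this family of sandwiches with the calibration
`TiltCalibration` at θ and the rough-tuple bound `RoughTupleBound` at θ into `BatemanHornAsymptotic f`. -/
@[closes "route-Parity-VanishingDimension"] theorem closes (h₁ : TiltedLevel) (h₂ : TiltCalibration) (h₃ : DimensionZeroSandwich)
    (h₄ : RoughTupleBound) (h₅ : PrimeCellExtraction) : _root_.BatemanHorn := by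
  intro k f hf
  obtain ⟨θ, hθ, hθ', z₀, hz₀, hK1⟩ := h₁ k f hf
  refine h₅ k f hf θ hθ hθ' ?_ (h₂ k f hf θ hθ hθ') (h₄ k f hf θ hθ hθ')
  intro ε hε
  obtain ⟨z₁, hz₁, hS⟩ := h₃ k f hf θ hθ hθ' ε hε
  refine ⟨min z₀ z₁, lt_min hz₀ hz₁, fun z hz hzlt => ?_⟩
  exact hS z hz (lt_of_lt_of_le hzlt (min_le_right _ _)) (hK1 z hz (lt_of_lt_of_le hzlt (min_le_left _ _)))

end Summit.Parity.BatemanHorn.Theses.VanishingDimension
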